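import Literature.NumberTheory.Sieve.GrahamWeights
import Literature.NumberTheory.LFunctions.ZetaClassicalRegionBounds
import HarnessLib

/-!
# The Dirichlet series of `(ψ∗1)²` at `ω > 1` for Graham's weights

Topic `Literature/NumberTheory/Sieve`. Everything here is PROVED. The exact identity
`Σ_{n ≥ 1} (ψ∗1)(n)² n^{-ω} = D_ψ(ω) · Σ_{m ≥ 1} m^{-ω}` (`tsum_psiStar_sq_mul_rpow_eq`: expand the
square, `d ∣ n ∧ e ∣ n ↔ [d,e] ∣ n`, and sum over the multiples of `[d,e]`), the bound
`Σ_{m ≥ 1} m^{-ω} ≤ ω/(ω−1)` (`tsum_rpow_neg_le`, from the tree's `ζ(σ) ≤ σ/(σ−1)`), and hence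
for every finite range (`sum_psiStar_sq_mul_rpow_le`)

  `Σ_{n ≤ M} (ψ∗1)(n)² n^{-(1+δ)} ≤ (1 + 1/δ) D_ψ(1+δ)`
  `≤ (1 + 1/δ) · 196 e^{10} (1 + δ log V)² log V / log²(V/U)`.

With `δ = 1/log X` this is Motohashi's form of the sieve side (`Σ_n (ψ∗1)(n)² n^{-1} e^{-n/X} ≪ 1`)
of the Graham–Heath-Brown log-free zero-density argument, obtained from the Dirichlet series
instead of Graham's asymptotic for the partial sums `Σ_{n ≤ N} (ψ∗1)(n)²` (no middle range).

## References
* D. R. Heath-Brown, PLMS 64 (1992), §11 (11.13)–(11.14). [cite: HeathBrown1992PLMS, §11]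
* Y. Motohashi, *解析的整数論 I* (Asakura, 2009), Lemma 9.4 (9.2.11)–(9.2.15). [folklore]
-/

noncomputable section

open Finset Real ArithmeticFunction

open scoped ArithmeticFunction.Moebius

namespace Literature.NumberTheory.Sieve.GrahamWeights

variable {U V : ℝ}

/-! ### Series over multiples -/

/-- A series supported on the multiples of `k ≥ 1` is a series over `m ↦ km`. [folklore] -/
theorem tsum_ite_dvd_eq' {k : ℕ} (hk : 0 < k) (F : ℕ → ℝ) :
    ∑' n : ℕ, (if k ∣ n then F n else 0) = ∑' m : ℕ, F (k * m) := by
  have hinj : Function.Injective (fun m : ℕ => k * m) := fun a b h => Nat.eq_of_mul_eq_mul_left hk h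
  rw [← hinj.tsum_eq]
  · exact tsum_congr fun m => by simp
  · intro n hn
    rw [Function.mem_support] at hn
    by_cases h : k ∣ n
    · obtain ⟨m, rfl⟩ := h
      exact ⟨m, rfl⟩
    · exact absurd (if_neg h) hn

/-- Summability of `n ↦ n^{-ω}` over `ℕ` for `ω > 1`. [folklore] -/
theorem summable_rpow_neg {ω : ℝ} (hω : 1 < ω) : Summable fun n : ℕ => (n : ℝ) ^ (-ω) :=
  Real.summable_nat_rpow.2 (by linarith)

/-- Summability of the series over the multiples of `k`. [folklore] -/
theorem summable_ite_dvd_rpow (k : ℕ) {ω : ℝ} (hω : 1 < ω) :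
    Summable fun n : ℕ => if k ∣ n then (n : ℝ) ^ (-ω) else 0 := by
  refine Summable.of_nonneg_of_le (fun n => ?_) (fun n => ?_) (summable_rpow_neg hω)
  · split_ifs <;> positivity
  · split_ifs <;> [exact le_rfl; positivity]

/-- `Σ_{n : k ∣ n} n^{-ω} = k^{-ω} Σ_m m^{-ω}` (`k ≥ 1`, `ω > 1`). [folklore] -/
theorem tsum_ite_dvd_rpow_eq {k : ℕ} (hk : 0 < k) (ω : ℝ) :
    ∑' n : ℕ, (if k ∣ n then (n : ℝ) ^ (-ω) else 0) =
      (k : ℝ) ^ (-ω) * ∑' m : ℕ, (m : ℝ) ^ (-ω) := by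
  rw [tsum_ite_dvd_eq' hk, ← tsum_mul_left]
  refine tsum_congr fun m => ?_
  rw [Nat.cast_mul, Real.mul_rpow (Nat.cast_nonneg k) (Nat.cast_nonneg m)]

/-- **`Σ_{m ≥ 1} m^{-ω} ≤ ω/(ω − 1)`** for real `ω > 1` (the `m = 0` term is `0`; the tree's
`ζ(σ) ≤ σ/(σ−1)`). [cite: Titchmarsh1986, §2.1 eq. (2.1.4)] -/
theorem tsum_rpow_neg_le {ω : ℝ} (hω : 1 < ω) : ∑' m : ℕ, (m : ℝ) ^ (-ω) ≤ ω / (ω - 1) := by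
  have hsum1 : LSeriesSummable 1 (ω : ℂ) := LSeriesSummable_one_iff.2 (by simp [hω])
  have h2 : ∀ n : ℕ, (n : ℝ) ^ (-ω) = (LSeries.term 1 (ω : ℂ) n).re := by
    intro n
    rcases eq_or_ne n 0 with rfl | hn
    · simp [Real.zero_rpow (neg_ne_zero.2 (by linarith : ω ≠ 0))]
    rw [LSeries.term_of_ne_zero hn]
    simp only [Pi.one_apply]
    have : (n : ℂ) ^ (ω : ℂ) = ((n : ℝ) ^ ω : ℝ) := by
      rw [Complex.ofReal_cpow (Nat.cast_nonneg n)]; simp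
    rw [this, show (1 : ℂ) = ((1 : ℝ) : ℂ) from rfl, ← Complex.ofReal_div, Complex.ofReal_re,
      Real.rpow_neg (Nat.cast_nonneg n), one_div]
  have h3 : (LSeries 1 (ω : ℂ)).re = ∑' n, (LSeries.term 1 (ω : ℂ) n).re := by
    rw [LSeries, Complex.re_tsum hsum1]
  calc ∑' m : ℕ, (m : ℝ) ^ (-ω) = ∑' n, (LSeries.term 1 (ω : ℂ) n).re := tsum_congr h2
    _ = (LSeries 1 (ω : ℂ)).re := h3.symm
    _ = (riemannZeta ω).re := by rw [LSeries_one_eq_riemannZeta (by simp [hω])]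
    _ ≤ ω / (ω - 1) := Literature.NumberTheory.LFunctions.ZetaClassicalRegion.riemannZeta_ofReal_re_le hω

/-- `0 ≤ Σ_m m^{-ω}`. [folklore] -/
theorem tsum_rpow_neg_nonneg (ω : ℝ) : 0 ≤ ∑' m : ℕ, (m : ℝ) ^ (-ω) :=
  tsum_nonneg fun m => by positivity

/-! ### The identity -/

/-- `(ψ∗1)(n)² n^{-ω}` as a finite double sum over `d, e ≤ ⌊V⌋` (all `n`; both sides vanish at
`n = 0` for `ω ≠ 0`). [folklore] -/
theorem psiStar_sq_mul_rpow_eq (hU : 0 < U) (hUV : U ≤ V) {ω : ℝ} (hω : ω ≠ 0) (n : ℕ) :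
    psiStar U V n ^ 2 * (n : ℝ) ^ (-ω) =
      ∑ d ∈ Icc 1 ⌊V⌋₊, ∑ e ∈ Icc 1 ⌊V⌋₊,
        psi U V d * psi U V e * (if Nat.lcm d e ∣ n then (n : ℝ) ^ (-ω) else 0) := by
  rcases eq_or_ne n 0 with rfl | hn
  · simp [psiStar_zero, Real.zero_rpow (neg_ne_zero.2 hω)]
  rw [psiStar_eq_sum_filter hU hUV le_rfl hn, sum_filter, sq, sum_mul_sum, sum_mul]
  refine sum_congr rfl fun d _ => ?_
  rw [sum_mul]
  refine sum_congr rfl fun e _ => ?_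
  have hiff : Nat.lcm d e ∣ n ↔ d ∣ n ∧ e ∣ n := Nat.lcm_dvd_iff
  by_cases hd : d ∣ n <;> by_cases he : e ∣ n <;> simp [hd, he, hiff]

/-- Summability of `(ψ∗1)(n)² n^{-ω}` for `ω > 1`. [folklore] -/
theorem summable_psiStar_sq_mul_rpow (hU : 0 < U) (hUV : U ≤ V) {ω : ℝ} (hω : 1 < ω) :
    Summable fun n : ℕ => psiStar U V n ^ 2 * (n : ℝ) ^ (-ω) := by
  have h := fun n => psiStar_sq_mul_rpow_eq hU hUV (by linarith : ω ≠ 0) n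
  rw [show (fun n : ℕ => psiStar U V n ^ 2 * (n : ℝ) ^ (-ω)) = fun n => ∑ d ∈ Icc 1 ⌊V⌋₊,
      ∑ e ∈ Icc 1 ⌊V⌋₊, psi U V d * psi U V e * (if Nat.lcm d e ∣ n then (n : ℝ) ^ (-ω) else 0)
    from funext h]
  refine summable_sum fun d _ => summable_sum fun e _ => ?_
  exact (summable_ite_dvd_rpow _ hω).mul_left _

/-- **The Dirichlet series identity**: for `0 < U ≤ V` and `ω > 1`,
`Σ_n (ψ∗1)(n)² n^{-ω} = D_ψ(ω) · Σ_m m^{-ω}`. [cite: HeathBrown1992PLMS, §11 (11.14)] -/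
theorem tsum_psiStar_sq_mul_rpow_eq (hU : 0 < U) (hUV : U ≤ V) {ω : ℝ} (hω : 1 < ω) :
    ∑' n : ℕ, psiStar U V n ^ 2 * (n : ℝ) ^ (-ω) =
      quadForm U V ω * ∑' m : ℕ, (m : ℝ) ^ (-ω) := by
  have h := fun n => psiStar_sq_mul_rpow_eq hU hUV (by linarith : ω ≠ 0) n
  rw [tsum_congr h]
  rw [Summable.tsum_finsetSum fun d _ => summable_sum fun e _ =>
    (summable_ite_dvd_rpow _ hω).mul_left _]
  rw [quadForm, sum_mul]
  refine sum_congr rfl fun d hd => ?_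
  rw [Summable.tsum_finsetSum fun e _ => (summable_ite_dvd_rpow _ hω).mul_left _, sum_mul]
  refine sum_congr rfl fun e he => ?_
  have hd0 : 0 < d := (mem_Icc.1 hd).1
  have he0 : 0 < e := (mem_Icc.1 he).1
  have hlcm : 0 < Nat.lcm d e := Nat.pos_of_ne_zero (Nat.lcm_ne_zero hd0.ne' he0.ne')
  rw [tsum_mul_left, tsum_ite_dvd_rpow_eq hlcm]
  ring

/-- `D_ψ(ω) ≥ 0` for `ω > 1` (it is a limit of non-negative partial sums, or, by the
diagonalisation, a sum of squares). [folklore] -/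
theorem quadForm_nonneg (hU : 0 < U) (hUV : U ≤ V) {ω : ℝ} (hω : 1 < ω) : 0 ≤ quadForm U V ω := by
  have h := tsum_psiStar_sq_mul_rpow_eq hU hUV hω
  have hpos : 0 < ∑' m : ℕ, (m : ℝ) ^ (-ω) := by
    have h1 : (1 : ℝ) ≤ ∑' m : ℕ, (m : ℝ) ^ (-ω) := by
      have := (summable_rpow_neg hω).le_tsum 1 (fun m _ => by positivity)
      simpa using this
    linarith
  have hnn : 0 ≤ ∑' n : ℕ, psiStar U V n ^ 2 * (n : ℝ) ^ (-ω) :=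
    tsum_nonneg fun n => by positivity
  rw [h] at hnn
  exact nonneg_of_mul_nonneg_left hnn hpos

/-- **Finite ranges**: for `0 < U ≤ V`, `ω > 1` and every `M`,
`Σ_{n < M} (ψ∗1)(n)² n^{-ω} ≤ D_ψ(ω) · ω/(ω−1)`. [cite: HeathBrown1992PLMS, §11 (11.14)] -/
theorem sum_psiStar_sq_mul_rpow_le (hU : 0 < U) (hUV : U ≤ V) {ω : ℝ} (hω : 1 < ω) (M : ℕ) :
    ∑ n ∈ Finset.range M, psiStar U V n ^ 2 * (n : ℝ) ^ (-ω) ≤ quadForm U V ω * (ω / (ω - 1)) := by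
  calc ∑ n ∈ Finset.range M, psiStar U V n ^ 2 * (n : ℝ) ^ (-ω)
      ≤ ∑' n : ℕ, psiStar U V n ^ 2 * (n : ℝ) ^ (-ω) :=
        (summable_psiStar_sq_mul_rpow hU hUV hω).sum_le_tsum _ fun n _ => by positivity
    _ = quadForm U V ω * ∑' m : ℕ, (m : ℝ) ^ (-ω) := tsum_psiStar_sq_mul_rpow_eq hU hUV hω
    _ ≤ quadForm U V ω * (ω / (ω - 1)) :=
        mul_le_mul_of_nonneg_left (tsum_rpow_neg_le hω) (quadForm_nonneg hU hUV hω)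

/-- **The sieve side at `1 + δ`** (Graham weights, Motohashi's form): for `1 ≤ U < V`, `2 ≤ V`,
`δ > 0` and every `M`,
`Σ_{n < M} (ψ∗1)(n)² n^{-(1+δ)} ≤ (1 + 1/δ) · 196 e^{10} (1 + δ log V)² log V / log²(V/U)`.
[cite: HeathBrown1992PLMS, §11 (11.13)–(11.14)] -/
theorem sum_psiStar_sq_mul_rpow_le_explicit (hU : 1 ≤ U) (hUV : U < V) (hV : 2 ≤ V) {δ : ℝ}
    (hδ : 0 < δ) (M : ℕ) :
    ∑ n ∈ Finset.range M, psiStar U V n ^ 2 * (n : ℝ) ^ (-(1 + δ)) ≤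
      (1 + 1 / δ) * (196 * Real.exp 10 * (1 + δ * Real.log V) ^ 2 * Real.log V /
        Real.log (V / U) ^ 2) := by
  have hU0 : 0 < U := by linarith
  have h := sum_psiStar_sq_mul_rpow_le hU0 hUV.le (ω := 1 + δ) (by linarith) M
  have hq := quadForm_le hU hUV hV hδ.le
  have hq0 := quadForm_nonneg hU0 hUV.le (ω := 1 + δ) (by linarith)
  have hωeq : (1 + δ) / (1 + δ - 1) = 1 + 1 / δ := by
    rw [show (1 + δ - 1 : ℝ) = δ by ring, add_div, div_self hδ.ne', add_comm]
  rw [hωeq] at h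
  calc _ ≤ quadForm U V (1 + δ) * (1 + 1 / δ) := h
    _ ≤ _ := by rw [mul_comm]; exact mul_le_mul_of_nonneg_left hq (by positivity)

end Literature.NumberTheory.Sieve.GrahamWeights
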